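import Summits.ValiantsHypothesis.ValiantsHypothesis.Theorems.DefinabilityGapBlockPermanent
import Summits.ValiantsHypothesis.ValiantsHypothesis.Theorems.DefinabilityGapLabelSupport
import HarnessLib

/-!
# DefinabilityGap — BLOCK RIGIDITY, stage H3: the δ-parameter (`rectangle_or_sq_le_nuCount`)

Route `route-ValiantsHypothesis-DefinabilityGap` (DRAFT), read-once leaf F4 / W10 (aside `KIPlantedHittingRO`,
stmt-ValiantsHypothesis-23704), leaf `ZperHits₂(m)` = hypothesis `hZ` of
`DefinabilityGapZperTransfer.chainVal_eq_zero_of_bind₁_kiPer`; census cell F4/W10 rung_ladder.next ‖ v35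
«δ-parameter» (decomp-valiant bus, OFFER O-L5-BK / CALL (A) of 2026-08-31T01:49Z; last file of the series
H1a `DefinabilityGapAdmissibleBlocks` / H1b `DefinabilityGapBlockExclusion` / H2 `DefinabilityGapBlockPermanent`).

**THEOREM** (`rectangle_or_sq_le_nuCount`, the δ-PARAMETER). `K` any field; `l` a width-2 chain of
univariate-image links `M_j(ℓ_j)` (`M_j ∈ K[t]^{2×2}`, `|vars ℓ_j| ≤ c`) computing a VOID:
`uᵀ L v = per_m · H ≠ 0`.
Let `ν = nuCount l` be the number of NON-UNIT links (`¬ IsUnit (det M_j)`) and `N = nuSupport l` the set of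
cells occurring in their labels. Then EITHER `N` contains a rectangle `R × C` with `|R| + |C| ≥ m + 1` (no
perfect matching survives off `N`, Frobenius–König), OR `m² ≤ 2c·ν + c·m`, i.e. `ν ≥ m(m - c)/(2c)`
(`c = 2`: `ν ≥ ⌈m(m-2)/4⌉`, `zperHits_of_nuCount_lt`). E3 gave `ν ≥ ⌈(m-1)/c⌉`.

Proof (BLOCK CENSUS of a cell set `T ⊇` the non-unit labels, `avoid T ≠ ∅`). (A) If some block `R_[a]` of the
admissible pattern of `T` has more than `c` rows, the BLOCK PERMANENT `Q^[a]` (H2: prime, divides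
`Q_{T'} = topForm Φ_{T'}(per_m)` for `T' = T ∪ {off-block cells off σ₀}`, and prime to every non-zero `c`-local
top form since its monomials meet `|C_[a]| > c` columns) runs E3's generic-`ι` S-rigidity engine with a prime
FACTOR (`chainVal_eq_zero_of_support_of_factor`, E2 `chainVal_eq_zero_of_prime_of_eq_mul` underneath): no void
(`chainVal_eq_zero_of_bigBlock`). (B) If every block has at most `c` rows, H1b's QUADRATIC COUNT gives
`m² ≤ 2|T| + c·m` (`rectangle_or_sq_le_of_void`); with `T = N`, `|N| ≤ c·ν`. (C) `avoid T = ∅`: a rectangle.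

HONEST LIMITS (critic CALL (A)). (1) Branch (C) is NOT decided here — off a cell set meeting every perfect
matching only `|T| ≥ m` follows, so the UNCONDITIONAL support bound moves merely from `m - 1` (E3) to `m`; the
quadratic bound is for void supports off which a perfect matching survives (successor cell H4 «max-matching
top form», not in this file). (2) The count of (B) is tight for `Q_T` (`m = 4`, `c = 2`, `T = {0,1} × {2,3}`:
`Q_T = per₂ · per₂`, `2|T| = 8 = m² - Σ_a |R_[a]|`), so inside this method the bound is optimal. (3) Closes NO
item; 0 S-currency; rung 0 (LADDER-Valiant); not K2c; the leaf `ZperHits₂(m)`, `KIPlantedHittingRO`'s tag and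
VP ≠ VNP are untouched. HONEST GRADE: KNOWN INGREDIENTS (Dulmage–Mendelsohn / Brualdi canonical form
[cite: BrualdiRyser1991, Thm. 4.2.6/4.2.7], Hall, Frobenius–König, irreducibility of fully indecomposable
permanents [cite: BrualdiRyser1991, Thm. 9.2.4]) in a NEW COMBINATION on this leaf (column-width KEY for a
component factor + E3 engine with a prime factor + dichotomy); kernel-new. No facts, no Prop-valued
definitions, no placeholders; data definitions `nuSupport`, `nuCount`.
-/

set_option linter.dupNamespace false

open MvPolynomial Finset
open Literature.Computability.AlgebraicComplexity
open Summit.ValiantsHypothesis.ValiantsHypothesis.Theorems.DefinabilityGapUnitRigidityForms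
open Summit.ValiantsHypothesis.ValiantsHypothesis.Theorems.DefinabilityGapZperTransfer
open Summit.ValiantsHypothesis.ValiantsHypothesis.Theorems.DefinabilityGapZeroPatternPermanent
open Summit.ValiantsHypothesis.ValiantsHypothesis.Theorems.DefinabilityGapPrimeRigidity
open Summit.ValiantsHypothesis.ValiantsHypothesis.Theorems.DefinabilityGapLabelSupport
open Summit.ValiantsHypothesis.ValiantsHypothesis.Theorems.DefinabilityGapAdmissibleBlocks
open Summit.ValiantsHypothesis.ValiantsHypothesis.Theorems.DefinabilityGapBlockExclusion
open Summit.ValiantsHypothesis.ValiantsHypothesis.Theorems.DefinabilityGapBlockPermanent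

namespace Summit.ValiantsHypothesis.ValiantsHypothesis.Theorems.DefinabilityGapBlockRigidity

noncomputable section

variable {m : ℕ}

section Rigidity

variable {K : Type*} [Field K] {K' : Type*} [Field K'] (ι : MvPolynomial (Fin m × Fin m) K →+* K') {c : ℕ}

/-- S-RIGIDITY WITH A PRIME FACTOR of `Q_T` (E3 `chainVal_eq_zero_of_support_of_prime` with the prime
`Q ∣ Q_T = topForm Φ_T(per_m)` in place of `Q_T`). [this file] -/
theorem chainVal_eq_zero_of_support_of_factor (hι : Function.Injective ι) {T : Finset (Fin m × Fin m)}
    {Q : MvPolynomial (Fin m × Fin m) K'} (hQ : Prime Q)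
    (hkey : ∀ f ∈ locSpan K' (Fin m × Fin m) c, f ≠ 0 → ¬ Q ∣ topForm f) (hT : zpPer K' T ≠ 0)
    (hdvd : Q ∣ zpPer K' T)
    (l : List (Matrix (Fin 2) (Fin 2) (Polynomial K) × MvPolynomial (Fin m × Fin m) K))
    (hloc : ∀ e ∈ l, ∃ S : Finset (Fin m × Fin m), S.card ≤ c ∧ e.2.vars ⊆ S)
    (hsup : ∀ e ∈ l, IsUnit e.1.det ∨ e.2.vars ⊆ T) (u v : Fin 2 → K)
    (H : MvPolynomial (Fin m × Fin m) K) (h : chainVal (l.map ulink) u v = perPoly (Fin m) K * H) :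
    chainVal (l.map ulink) u v = 0 := by
  have hspec : spec ι T (chainVal (l.map ulink) u v) = chainVal ((l.map ulink).map fun N => N.map (spec ι T))
      (fun i => (ι.comp C) (u i)) (fun k => (ι.comp C) (v k)) :=
    map_chainVal (spec ι T) (ι.comp C) (spec_C ι T) _ u v
  have hP : Q ∣ topForm (spec ι T (perPoly (Fin m) K)) := by
    rw [topForm_spec_perPoly ι T hT]; exact hdvd
  have key : chainVal ((l.map ulink).map fun N => N.map (spec ι T)) (fun i => (ι.comp C) (u i))
      (fun k => (ι.comp C) (v k)) = 0 := by
    refine chainVal_eq_zero_of_prime_of_eq_mul hQ hkey hP _ ?_ _ _ (spec ι T H) (by rw [← hspec, h, map_mul])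
    intro N hN
    obtain ⟨N', hN', rfl⟩ := List.mem_map.1 hN
    obtain ⟨e, he, rfl⟩ := List.mem_map.1 hN'
    exact spec_ulink_mem ι T (hloc e he) (hsup e he)
  exact spec_injective ι hι T (by rw [hspec, key, map_zero])

/-- **BLOCK RIGIDITY (branch A).** `K` any field; `T` a cell set avoided by some permutation and having a
block with more than `c` rows; a width-2 chain of univariate-image links with `c`-local labels, every link a
unit link or `T`-labelled: `per_m ∣ uᵀ L v ⇒ uᵀ L v = 0` (the block permanent `Q^[a]` over `K(Y)` is the
prime: H2 `blockPer_prime`, `not_blockPer_dvd_topForm`, `zpPer_union_eq_blockPer_mul`). [this file] -/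
theorem chainVal_eq_zero_of_bigBlock {T : Finset (Fin m × Fin m)} (h0 : (avoid T).Nonempty) {a : Fin m}
    (ha : c < (rowBlock T a).card)
    (l : List (Matrix (Fin 2) (Fin 2) (Polynomial K) × MvPolynomial (Fin m × Fin m) K))
    (hloc : ∀ e ∈ l, ∃ S : Finset (Fin m × Fin m), S.card ≤ c ∧ e.2.vars ⊆ S)
    (hsup : ∀ e ∈ l, IsUnit e.1.det ∨ e.2.vars ⊆ T) (u v : Fin 2 → K)
    (H : MvPolynomial (Fin m × Fin m) K) (h : chainVal (l.map ulink) u v = perPoly (Fin m) K * H) :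
    chainVal (l.map ulink) u v = 0 := by
  obtain ⟨σ₀, hσ₀⟩ := h0
  have hE := zpPer_union_eq_blockPer_mul (R := FractionRing (MvPolynomial (Fin m × Fin m) K)) T hσ₀ a
  refine chainVal_eq_zero_of_support_of_factor (algebraMap _ (FractionRing (MvPolynomial (Fin m × Fin m) K)))
    (IsFractionRing.injective _ _) (blockPer_prime hσ₀ a)
    (fun f hf hf0 => not_blockPer_dvd_topForm hσ₀ ha hf hf0) ?_ ⟨_, hE⟩ l hloc
    (fun e he => (hsup e he).imp_right fun hs => hs.trans subset_union_left) u v H h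
  rw [hE]
  exact mul_ne_zero (blockPer_ne_zero hσ₀ a) (prod_ne_zero_iff.2 fun i _ => X_ne_zero _)

/-- **VOID PLACEMENT (the dichotomy).** In a VOID — a non-zero chain value divisible by `per_m`, all labels
`c`-local — every cell set `T` carrying the labels of all non-unit links either contains a rectangle `R × C`
with `|R| + |C| ≥ m + 1` (no perfect matching off `T`), or satisfies `m² ≤ 2·|T| + c·m`. [this file] -/
theorem rectangle_or_sq_le_of_void (T : Finset (Fin m × Fin m))
    (l : List (Matrix (Fin 2) (Fin 2) (Polynomial K) × MvPolynomial (Fin m × Fin m) K))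
    (hloc : ∀ e ∈ l, ∃ S : Finset (Fin m × Fin m), S.card ≤ c ∧ e.2.vars ⊆ S)
    (hsup : ∀ e ∈ l, IsUnit e.1.det ∨ e.2.vars ⊆ T) (u v : Fin 2 → K)
    (H : MvPolynomial (Fin m × Fin m) K) (h : chainVal (l.map ulink) u v = perPoly (Fin m) K * H)
    (hne : chainVal (l.map ulink) u v ≠ 0) :
    (∃ R C : Finset (Fin m), m + 1 ≤ R.card + C.card ∧ R ×ˢ C ⊆ T) ∨ m * m ≤ 2 * T.card + c * m := by
  by_cases h0 : avoid T = ∅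
  · exact Or.inl (exists_rectangle_of_avoid_eq_empty h0)
  have h0' : (avoid T).Nonempty := nonempty_iff_ne_empty.2 h0
  refine Or.inr (sq_le_of_card_rowBlock_le T h0' fun a => ?_)
  by_contra hlt
  exact hne (chainVal_eq_zero_of_bigBlock h0' (not_le.1 hlt) l hloc hsup u v H h)

open scoped Classical in
/-- The NON-UNIT SUPPORT of a chain: the cells occurring in the labels of its non-unit links. [this file] -/
def nuSupport (l : List (Matrix (Fin 2) (Fin 2) (Polynomial K) × MvPolynomial (Fin m × Fin m) K)) :
    Finset (Fin m × Fin m) :=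
  univ.filter fun x => ∃ e ∈ l, ¬ IsUnit e.1.det ∧ x ∈ e.2.vars

open scoped Classical in
/-- The number `δ` of NON-UNIT links of a chain. [this file] -/
def nuCount (l : List (Matrix (Fin 2) (Fin 2) (Polynomial K) × MvPolynomial (Fin m × Fin m) K)) : ℕ :=
  (l.filter fun e => ¬ IsUnit e.1.det).length

/-- `|nuSupport l| ≤ c · nuCount l` for `c`-local labels. [this file] -/
theorem card_nuSupport_le (l : List (Matrix (Fin 2) (Fin 2) (Polynomial K) × MvPolynomial (Fin m × Fin m) K))
    (hloc : ∀ e ∈ l, ∃ S : Finset (Fin m × Fin m), S.card ≤ c ∧ e.2.vars ⊆ S) :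
    (nuSupport l).card ≤ c * nuCount l := by
  classical
  induction l with
  | nil => simp [nuSupport, nuCount]
  | cons e l ih =>
    have ih' := ih fun e' he' => hloc e' (List.mem_cons_of_mem _ he')
    obtain ⟨S, hS, heS⟩ := hloc e List.mem_cons_self
    have hsub : nuSupport (e :: l) ⊆ nuSupport l ∪ (if IsUnit e.1.det then ∅ else S) := by
      intro x hx
      have hx' := hx
      simp only [nuSupport, mem_filter, mem_univ, true_and, List.mem_cons, exists_eq_or_imp] at hx'
      rcases hx' with hx' | hx'
      · rw [mem_union, if_neg hx'.1]; exact Or.inr (heS hx'.2)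
      · refine mem_union_left _ ?_
        simp only [nuSupport, mem_filter, mem_univ, true_and]
        exact hx'
    have hcnt : nuCount (e :: l) = nuCount l + (if IsUnit e.1.det then 0 else 1) := by
      unfold nuCount
      rw [List.filter_cons]
      by_cases hu : IsUnit e.1.det <;> simp [hu]
    refine (card_le_card hsub).trans ((card_union_le _ _).trans ?_)
    rw [hcnt, mul_add]
    refine add_le_add ih' ?_
    split_ifs <;> simp [hS]

/-- **QUADRATIC δ.** In a void with `c`-local labels, either the non-unit support contains a rectangle
`R × C` with `|R| + |C| ≥ m + 1`, or the number `δ` of non-unit links satisfies `m² ≤ 2c·δ + c·m`, i.e.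
`δ ≥ m(m-c)/(2c)`. [this file] -/
theorem rectangle_or_sq_le_nuCount
    (l : List (Matrix (Fin 2) (Fin 2) (Polynomial K) × MvPolynomial (Fin m × Fin m) K))
    (hloc : ∀ e ∈ l, ∃ S : Finset (Fin m × Fin m), S.card ≤ c ∧ e.2.vars ⊆ S) (u v : Fin 2 → K)
    (H : MvPolynomial (Fin m × Fin m) K) (h : chainVal (l.map ulink) u v = perPoly (Fin m) K * H)
    (hne : chainVal (l.map ulink) u v ≠ 0) :
    (∃ R C : Finset (Fin m), m + 1 ≤ R.card + C.card ∧ R ×ˢ C ⊆ nuSupport l) ∨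
      m * m ≤ 2 * c * nuCount l + c * m := by
  classical
  have hsup : ∀ e ∈ l, IsUnit e.1.det ∨ e.2.vars ⊆ nuSupport l := fun e he =>
    or_iff_not_imp_left.2 fun hu x hx => by
      simp only [nuSupport, mem_filter, mem_univ, true_and]
      exact ⟨e, he, hu, hx⟩
  rcases rectangle_or_sq_le_of_void (nuSupport l) l hloc hsup u v H h hne with hR | hsq
  · exact Or.inl hR
  · have hc := card_nuSupport_le l hloc
    refine Or.inr (hsq.trans ?_)
    nlinarith [hc]

/-- FROBENIUS–KÖNIG, easy direction: a rectangle inside `T` with `|R| + |C| > m` meets every permutation.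
[cite: BrualdiRyser1991, Thm. 1.2.1] -/
theorem card_add_card_le_of_avoid {T : Finset (Fin m × Fin m)} {σ : Equiv.Perm (Fin m)} (hσ : σ ∈ avoid T)
    {R C : Finset (Fin m)} (h : R ×ˢ C ⊆ T) : R.card + C.card ≤ m := by
  have hd : Disjoint (C.image σ) R := disjoint_left.2 fun x hx hxR => by
    obtain ⟨i, hi, rfl⟩ := mem_image.1 hx
    exact mem_avoid.1 hσ i (h (mem_product.2 ⟨hxR, hi⟩))
  have hle := card_le_univ (C.image σ ∪ R)
  rw [card_union_of_disjoint hd, card_image_of_injective _ σ.injective, Fintype.card_fin] at hle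
  omega

/-- LEAF-SHAPED INSTANCE (`c = 2`): the leaf's hypothesis `hZ` for chains whose non-unit links are labelled
inside a cell set `T` avoided by some permutation and with `2·|T| < m(m-2)`. [this file] -/
theorem zperHits_of_nonunit_support (F : Type*) [Field F] (T : Finset (Fin m × Fin m))
    (h0 : (avoid T).Nonempty) (hT : 2 * T.card + 2 * m < m * m)
    (l : List (Matrix (Fin 2) (Fin 2) (Polynomial F) × MvPolynomial (Fin m × Fin m) F))
    (hl : ∀ e ∈ l, ∃ S : Finset (Fin m × Fin m), S.card ≤ 2 ∧ e.2.vars ⊆ S)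
    (hone : ∀ e ∈ l, IsUnit e.1.det ∨ e.2.vars ⊆ T) (u v : Fin 2 → F)
    (H : MvPolynomial (Fin m × Fin m) F) (h : chainVal (l.map ulink) u v = perPoly (Fin m) F * H) :
    chainVal (l.map ulink) u v = 0 := by
  by_contra hne
  rcases rectangle_or_sq_le_of_void (c := 2) T l hl hone u v H h hne with ⟨R, C, hRC, hsub⟩ | hsq
  · obtain ⟨σ, hσ⟩ := h0
    have := card_add_card_le_of_avoid hσ hsub
    omega
  · omega

/-- LEAF-SHAPED INSTANCE (`c = 2`, few non-unit links): a chain with `c = 2`-local labels, fewer than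
`m(m-2)/4` non-unit links and whose non-unit support is avoided by some permutation satisfies `hZ`.
[this file] -/
theorem zperHits_of_nuCount_lt (F : Type*) [Field F]
    (l : List (Matrix (Fin 2) (Fin 2) (Polynomial F) × MvPolynomial (Fin m × Fin m) F))
    (hl : ∀ e ∈ l, ∃ S : Finset (Fin m × Fin m), S.card ≤ 2 ∧ e.2.vars ⊆ S)
    (h0 : (avoid (nuSupport l)).Nonempty) (hδ : 4 * nuCount l + 2 * m < m * m) (u v : Fin 2 → F)
    (H : MvPolynomial (Fin m × Fin m) F) (h : chainVal (l.map ulink) u v = perPoly (Fin m) F * H) :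
    chainVal (l.map ulink) u v = 0 := by
  by_contra hne
  rcases rectangle_or_sq_le_nuCount (c := 2) l hl u v H h hne with ⟨R, C, hRC, hsub⟩ | hsq
  · obtain ⟨σ, hσ⟩ := h0
    have := card_add_card_le_of_avoid hσ hsub
    omega
  · omega

end Rigidity

end

end Summit.ValiantsHypothesis.ValiantsHypothesis.Theorems.DefinabilityGapBlockRigidity
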